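import Summits.Parity.GeneralizedHardyLittlewood.Theorems.PrimeLevelFamEdgeMomentsBeyondDiagonalDiagProfile
import Summits.Parity.GeneralizedHardyLittlewood.Theorems.PrimeLevelFamEdgeMomentsBeyondDiagonalDiagCoprime
import Literature.NumberTheory.Sieve.LevelOfDistributionProofs
import HarnessLib

/-!
# Route `PrimeLevelFamEdge`, crux K_A `MomentsBeyondDiagonal` (stmt-Parity-20007), line «petersson_layers» v4, stub `stub_diag`:
# **the profile coordinate `𝒮_n = E_n·P″(log(M/n)/log M)/log²M + O_P(D(n)(1/((1+log(M/n))²log²M) + 1/log³M))`**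

Census item G5a of the `stub_diag` repair census (`Lines/petersson_layers_stub_diag_g4_bricks.md`). In the kernel
form of a general profile `P` in Selberg coordinates (`quadForm_profile_eq`, file `…DiagProfile`),
`Σ_{a,b≤M} x_a x_b K_L(a,b) = Σ_{n≤M} φ(n)W(n)²((L+κ(n))𝒮_n² + 2𝒮_n𝒫_n)` with the PROFILE COORDINATE
`𝒮_n = Σ_{c ≤ deg P} P_c·S⁽ᶜ⁾(M/n;n)/logᶜM`, `S⁽ᶜ⁾(y;n) = Σ_{k≤y,(k,n)=1}τ(k)W(k)logᶜ(y/k)`. Feeding the order-`c`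
evaluations `S⁽²⁾(y;n) = 2E_n + O(D(n)/(1+log y)²)` (`KernelFormXSqCore.abs_coprimeSum_sub_le`) and
`S⁽ᶜ⁾(y;n) = c(c−1)E_n log^{c−2}y + O_c(D(n)(1+log y)^{c−3})` (`c ≥ 3`, `…DiagCoprime.abs_coprimeSumPow_sub_le`):

* `abs_coprimeSumPow_div_sub_le` — per order `c ≥ 3`, for `M ≥ 3`, `1 ≤ n ≤ M`:
  `|S⁽ᶜ⁾(M/n;n)/logᶜM − c(c−1)E_n log^{c−2}(M/n)/logᶜM| ≤ C_c·D(n)/log³M`;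
* `abs_profileCoord_sub_le` — for `P` with `P₀ = P₁ = 0` (admissible), `M ≥ 3`, `1 ≤ n ≤ M`:
  **`|𝒮_n − E_n·Σ_c P_c c(c−1)log^{c−2}(M/n)/logᶜM| ≤ C_P·D(n)·(1/((1+log(M/n))²log²M) + 1/log³M)`**;
* `sum_coeff_mul_desc_eq_derivative2_eval` — the main term IS `E_n·P″(u_n)/log²M`, `u_n = log(M/n)/log M`:
  `Σ_c P_c c(c−1)log^{c−2}(M/n)/logᶜM = P″(log(M/n)/log M)/log²M`;
* `abs_profileMain_le`, `abs_profileCoord_le` — the crude sizes `|main| ≤ C_P E_n/log²M`, `|𝒮_n| ≤ C_P·D(n)/log²M`.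

Def-free; theorems only. Helper `--supports stmt-Parity-20007`; closes nothing; K_A, K_B and the Parity summit are
NOT proved; nothing about Landau–Siegel zeros.

## References
* E. Kowalski, P. Michel, J. VanderKam, J. reine angew. Math. 526 (2000), (21)–(23) pp. 12–13 and Prop. 5.1 p. 18
  (the residue evaluation behind (31), in real variables, for a general profile).
  [cite: KowalskiMichelVanderKam2000, Prop. 5.1 — derivation]
-/

noncomputable section

open scoped Real ArithmeticFunction.Moebius ArithmeticFunction.sigma ArithmeticFunction.zeta
open Finset ArithmeticFunction Polynomial

namespace Summit.Parity.GeneralizedHardyLittlewood.Theorems.MomentsBeyondDiagonal.DiagKernel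

open Literature.NumberTheory.LFunctions Literature.NumberTheory.LFunctions.KMV2000
open Literature.NumberTheory.Sieve (one_le_log_of_three_le)
open Summit.Parity.GeneralizedHardyLittlewood.Theorems.BeyondDiagonalBeatsQuarter.KernelFormXSq
  (copTauW coprimeSum mainConst divWeight divWeight_nonneg mainConst_nonneg mainConst_le_divWeight
    abs_coprimeSum_sub_le)

/-- For `M ≥ 3` and `1 ≤ n ≤ M`: `0 ≤ log(M/n) ≤ log M`. [folklore] -/
theorem log_div_nonneg_and_le {M : ℝ} (hM : 3 ≤ M) {n : ℕ} (hn : n ≠ 0) (hnM : (n : ℝ) ≤ M) :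
    0 ≤ Real.log (M / n) ∧ Real.log (M / n) ≤ Real.log M := by
  have hn1 : (1 : ℝ) ≤ n := by exact_mod_cast Nat.one_le_iff_ne_zero.2 hn
  have hn0 : (0 : ℝ) < n := by linarith
  have hM0 : 0 < M := by linarith
  refine ⟨Real.log_nonneg ((one_le_div hn0).2 hnM), ?_⟩
  exact Real.log_le_log (div_pos hM0 hn0) (div_le_self hM0.le hn1)

/-! ### Per order `c ≥ 3` -/

/-- **Per-order profile coordinate** (`c ≥ 3`): for `M ≥ 3`, `1 ≤ n ≤ M`,
`|S⁽ᶜ⁾(M/n;n)/logᶜM − c(c−1)·E_n·log^{c−2}(M/n)/logᶜM| ≤ C_c·D(n)/log³M`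
(`(1+log(M/n))^{c−3} ≤ (2 log M)^{c−3}`).
[cite: KowalskiMichelVanderKam2000, Prop. 5.1 — derivation (profile `X^c`)] -/
theorem abs_coprimeSumPow_div_sub_le {c : ℕ} (hc : 3 ≤ c) :
    ∃ C : ℝ, 0 < C ∧ ∀ M : ℝ, 3 ≤ M → ∀ n : ℕ, n ≠ 0 → (n : ℝ) ≤ M →
      |(∑ k ∈ Icc 1 ⌊M / n⌋₊, copTauW n k * Real.log (M / n / k) ^ c) / Real.log M ^ c -
          (c : ℝ) * ((c : ℝ) - 1) * mainConst n * Real.log (M / n) ^ (c - 2) / Real.log M ^ c| ≤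
        C * divWeight n / Real.log M ^ 3 := by
  obtain ⟨K, hK, h⟩ := abs_coprimeSumPow_sub_le hc
  refine ⟨K * 2 ^ (c - 3), by positivity, fun M hM n hn hnM ↦ ?_⟩
  obtain ⟨m, rfl⟩ : ∃ m, c = m + 3 := ⟨c - 3, by omega⟩
  have e3 : m + 3 - 3 = m := by omega
  rw [e3]
  rw [e3] at h
  set ℓ := Real.log M with hℓ
  have hℓ1 : 1 ≤ ℓ := one_le_log_of_three_le hM
  have hℓ0 : 0 < ℓ := by linarith
  obtain ⟨hy0, hyℓ⟩ := log_div_nonneg_and_le hM hn hnM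
  have hn1 : (1 : ℝ) ≤ n := by exact_mod_cast Nat.one_le_iff_ne_zero.2 hn
  have hy1 : 1 ≤ M / n := (one_le_div (by linarith)).2 hnM
  have key := h n hn (M / n) hy1
  have hD := divWeight_nonneg n
  rw [← sub_div, abs_div, abs_of_pos (pow_pos hℓ0 _), div_le_iff₀ (pow_pos hℓ0 _)]
  calc |∑ k ∈ Icc 1 ⌊M / n⌋₊, copTauW n k * Real.log (M / n / k) ^ (m + 3) -
          ((m + 3 : ℕ) : ℝ) * (((m + 3 : ℕ) : ℝ) - 1) * mainConst n * Real.log (M / n) ^ (m + 3 - 2)|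
        ≤ K * divWeight n * (1 + Real.log (M / n)) ^ m := key
    _ ≤ K * divWeight n * (2 * ℓ) ^ m := by
        refine mul_le_mul_of_nonneg_left (pow_le_pow_left₀ (by linarith) (by linarith) m) (by positivity)
    _ = K * 2 ^ (m + 3 - 3) * divWeight n / ℓ ^ 3 * ℓ ^ (m + 3) := by
        rw [e3, mul_pow]
        field_simp
        ring

/-! ### The profile coordinate of an admissible profile -/

/-- **The profile coordinate** of a real polynomial `P` with `P₀ = P₁ = 0`: for `M ≥ 3`, `1 ≤ n ≤ M`,
`|Σ_c P_c S⁽ᶜ⁾(M/n;n)/logᶜM − E_n·Σ_c P_c c(c−1)log^{c−2}(M/n)/logᶜM| ≤ C_P·D(n)·(1/((1+log(M/n))²log²M) + 1/log³M)`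
(order `2`: `KernelFormXSqCore.abs_coprimeSum_sub_le`; orders `≥ 3`: `abs_coprimeSumPow_div_sub_le`; orders `0, 1` absent).
[cite: KowalskiMichelVanderKam2000, Prop. 5.1 — derivation (general profile, real variables)] -/
theorem abs_profileCoord_sub_le (P : ℝ[X]) (hP0 : P.coeff 0 = 0) (hP1 : P.coeff 1 = 0) :
    ∃ C : ℝ, 0 < C ∧ ∀ M : ℝ, 3 ≤ M → ∀ n : ℕ, n ≠ 0 → (n : ℝ) ≤ M →
      |∑ c ∈ Finset.range (P.natDegree + 1), P.coeff c *
            ((∑ k ∈ Icc 1 ⌊M / n⌋₊, copTauW n k * Real.log (M / n / k) ^ c) / Real.log M ^ c) -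
          mainConst n * ∑ c ∈ Finset.range (P.natDegree + 1), P.coeff c *
            ((c : ℝ) * ((c : ℝ) - 1) * Real.log (M / n) ^ (c - 2) / Real.log M ^ c)| ≤
        C * divWeight n * (1 / ((1 + Real.log (M / n)) ^ 2 * Real.log M ^ 2) + 1 / Real.log M ^ 3) := by
  obtain ⟨C₂, hC₂, h2⟩ := abs_coprimeSum_sub_le
  -- one constant per order, uniformly packaged (orders `< 3` get the dummy constant `1`)
  have hK : ∀ c : ℕ, ∃ K : ℝ, 0 < K ∧ (3 ≤ c → ∀ M : ℝ, 3 ≤ M → ∀ n : ℕ, n ≠ 0 → (n : ℝ) ≤ M →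
      |(∑ k ∈ Icc 1 ⌊M / n⌋₊, copTauW n k * Real.log (M / n / k) ^ c) / Real.log M ^ c -
          (c : ℝ) * ((c : ℝ) - 1) * mainConst n * Real.log (M / n) ^ (c - 2) / Real.log M ^ c| ≤
        K * divWeight n / Real.log M ^ 3) := by
    intro c
    by_cases hc : 3 ≤ c
    · obtain ⟨K, hK, h⟩ := abs_coprimeSumPow_div_sub_le hc
      exact ⟨K, hK, fun _ ↦ h⟩
    · exact ⟨1, one_pos, fun h ↦ absurd h hc⟩
  choose K hK0 hK using hK
  have hKsum : 0 ≤ ∑ c ∈ Finset.range (P.natDegree + 1), |P.coeff c| * K c :=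
    Finset.sum_nonneg fun c _ ↦ mul_nonneg (abs_nonneg _) (hK0 c).le
  refine ⟨C₂ * |P.coeff 2| + ∑ c ∈ Finset.range (P.natDegree + 1), |P.coeff c| * K c + 1,
    add_pos_of_nonneg_of_pos (add_nonneg (by positivity) hKsum) one_pos, fun M hM n hn hnM ↦ ?_⟩
  set ℓ := Real.log M with hℓ
  have hℓ1 : 1 ≤ ℓ := one_le_log_of_three_le hM
  have hℓ0 : 0 < ℓ := by linarith
  obtain ⟨hy0, hyℓ⟩ := log_div_nonneg_and_le hM hn hnM
  have hn1 : (1 : ℝ) ≤ n := by exact_mod_cast Nat.one_le_iff_ne_zero.2 hn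
  have hy1 : 1 ≤ M / n := (one_le_div (by linarith)).2 hnM
  have hD := divWeight_nonneg n
  set y := Real.log (M / n) with hy
  -- the per-order differences
  set d : ℕ → ℝ := fun c ↦
    (∑ k ∈ Icc 1 ⌊M / n⌋₊, copTauW n k * Real.log (M / n / k) ^ c) / ℓ ^ c -
      (c : ℝ) * ((c : ℝ) - 1) * mainConst n * y ^ (c - 2) / ℓ ^ c with hd
  have hdiff : ∑ c ∈ Finset.range (P.natDegree + 1), P.coeff c *
        ((∑ k ∈ Icc 1 ⌊M / n⌋₊, copTauW n k * Real.log (M / n / k) ^ c) / ℓ ^ c) -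
      mainConst n * ∑ c ∈ Finset.range (P.natDegree + 1), P.coeff c *
        ((c : ℝ) * ((c : ℝ) - 1) * y ^ (c - 2) / ℓ ^ c) =
      ∑ c ∈ Finset.range (P.natDegree + 1), P.coeff c * d c := by
    rw [Finset.mul_sum, ← Finset.sum_sub_distrib]
    refine Finset.sum_congr rfl fun c _ ↦ ?_
    simp only [hd]
    ring
  -- the two error scales
  set X : ℝ := C₂ * divWeight n / ((1 + y) ^ 2 * ℓ ^ 2) with hX
  set Y : ℝ := divWeight n / ℓ ^ 3 with hY
  have hX0 : 0 ≤ X := by positivity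
  have hY0 : 0 ≤ Y := by positivity
  -- order 2
  have hd2 : |d 2| ≤ C₂ * divWeight n / ((1 + y) ^ 2 * ℓ ^ 2) := by
    have e : d 2 = (coprimeSum n (M / n) - 2 * mainConst n) / ℓ ^ 2 := by
      simp only [hd, coprimeSum]
      norm_num
      ring
    rw [e, abs_div, abs_of_pos (pow_pos hℓ0 2), div_le_iff₀ (pow_pos hℓ0 2)]
    calc |coprimeSum n (M / n) - 2 * mainConst n| ≤ C₂ * divWeight n / (1 + y) ^ 2 := h2 n hn _ hy1
      _ = C₂ * divWeight n / ((1 + y) ^ 2 * ℓ ^ 2) * ℓ ^ 2 := by field_simp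
  -- termwise bound
  have hterm : ∀ c ∈ Finset.range (P.natDegree + 1),
      |P.coeff c * d c| ≤ (if c = 2 then |P.coeff c| * X else 0) + |P.coeff c| * K c * Y := by
    intro c _
    rw [abs_mul]
    have hKY : 0 ≤ |P.coeff c| * K c * Y := by have := hK0 c; positivity
    by_cases hc2 : c = 2
    · subst hc2
      rw [if_pos rfl]
      calc |P.coeff 2| * |d 2| ≤ |P.coeff 2| * X := mul_le_mul_of_nonneg_left hd2 (abs_nonneg _)
        _ ≤ |P.coeff 2| * X + |P.coeff 2| * K 2 * Y := le_add_of_nonneg_right hKY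
    · rw [if_neg hc2, zero_add]
      by_cases hc3 : 3 ≤ c
      · have h := hK c hc3 M hM n hn hnM
        calc |P.coeff c| * |d c| ≤ |P.coeff c| * (K c * divWeight n / ℓ ^ 3) :=
              mul_le_mul_of_nonneg_left h (abs_nonneg _)
          _ = |P.coeff c| * K c * Y := by simp only [hY]; ring
      · have hc01 : c = 0 ∨ c = 1 := by omega
        have hPc : P.coeff c = 0 := by rcases hc01 with rfl | rfl <;> assumption
        rw [hPc, abs_zero, zero_mul, zero_mul, zero_mul]
  rw [hdiff]
  calc |∑ c ∈ Finset.range (P.natDegree + 1), P.coeff c * d c|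
      ≤ ∑ c ∈ Finset.range (P.natDegree + 1), |P.coeff c * d c| := Finset.abs_sum_le_sum_abs _ _
    _ ≤ ∑ c ∈ Finset.range (P.natDegree + 1),
          ((if c = 2 then |P.coeff c| * X else 0) + |P.coeff c| * K c * Y) := Finset.sum_le_sum hterm
    _ = (∑ c ∈ Finset.range (P.natDegree + 1), if c = 2 then |P.coeff c| * X else 0) +
          (∑ c ∈ Finset.range (P.natDegree + 1), |P.coeff c| * K c) * Y := by
        rw [Finset.sum_add_distrib, Finset.sum_mul]
    _ ≤ |P.coeff 2| * X + (∑ c ∈ Finset.range (P.natDegree + 1), |P.coeff c| * K c) * Y := by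
        refine add_le_add ?_ le_rfl
        rw [Finset.sum_ite_eq']
        split_ifs
        · exact le_rfl
        · positivity
    _ = (C₂ * |P.coeff 2|) * (divWeight n * (1 / ((1 + y) ^ 2 * ℓ ^ 2))) +
          (∑ c ∈ Finset.range (P.natDegree + 1), |P.coeff c| * K c) * (divWeight n * (1 / ℓ ^ 3)) := by
        simp only [hX, hY]
        ring
    _ ≤ (C₂ * |P.coeff 2| + ∑ c ∈ Finset.range (P.natDegree + 1), |P.coeff c| * K c + 1) *
            (divWeight n * (1 / ((1 + y) ^ 2 * ℓ ^ 2))) +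
          (C₂ * |P.coeff 2| + ∑ c ∈ Finset.range (P.natDegree + 1), |P.coeff c| * K c + 1) *
            (divWeight n * (1 / ℓ ^ 3)) := by
        have hS0 : 0 ≤ ∑ c ∈ Finset.range (P.natDegree + 1), |P.coeff c| * K c :=
          Finset.sum_nonneg fun c _ ↦ by have := hK0 c; positivity
        have hA0 : 0 ≤ C₂ * |P.coeff 2| := by positivity
        gcongr
        · linarith
        · linarith
    _ = (C₂ * |P.coeff 2| + ∑ c ∈ Finset.range (P.natDegree + 1), |P.coeff c| * K c + 1) *
          divWeight n * (1 / ((1 + y) ^ 2 * ℓ ^ 2) + 1 / ℓ ^ 3) := by ring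

/-! ### The main term is `E_n·P″(u_n)/log²M` -/

/-- **`Σ_{c ≤ deg P} P_c·c(c−1)·log^{c−2}(M/n)/logᶜM = P″(log(M/n)/log M)/log²M`** (`log M ≠ 0`): the main term of
the profile coordinate is the second derivative of the profile at `u_n = log(M/n)/log M`.
[cite: KowalskiMichelVanderKam2000, Prop. 5.1 — derivation (the weight `P″` in (31))] -/
theorem sum_coeff_mul_desc_eq_derivative2_eval (P : ℝ[X]) {ℓ : ℝ} (hℓ : ℓ ≠ 0) (y : ℝ) :
    ∑ c ∈ Finset.range (P.natDegree + 1), P.coeff c * ((c : ℝ) * ((c : ℝ) - 1) * y ^ (c - 2) / ℓ ^ c) =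
      (derivative (derivative P)).eval (y / ℓ) / ℓ ^ 2 := by
  set f : ℕ → ℝ := fun c ↦ P.coeff c * ((c : ℝ) * ((c : ℝ) - 1) * y ^ (c - 2) / ℓ ^ c) with hf
  -- extend the range by two (the added coefficients vanish) and peel off the orders 0 and 1
  have hext : ∑ c ∈ Finset.range (P.natDegree + 1), f c = ∑ c ∈ Finset.range (P.natDegree + 1 + 2), f c := by
    have hsub : Finset.range (P.natDegree + 1) ⊆ Finset.range (P.natDegree + 1 + 2) :=
      Finset.range_mono (by omega)
    refine Finset.sum_subset hsub fun c hc hc' ↦ ?_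
    have hlt : P.natDegree < c := by
      have h2 : ¬ c < P.natDegree + 1 := fun h ↦ hc' (Finset.mem_range.2 h)
      omega
    simp only [hf, Polynomial.coeff_eq_zero_of_natDegree_lt hlt, zero_mul]
  have hpeel : ∑ c ∈ Finset.range (P.natDegree + 1 + 2), f c =
      ∑ i ∈ Finset.range (P.natDegree + 1), f (i + 2) := by
    rw [show P.natDegree + 1 + 2 = P.natDegree + 1 + 1 + 1 by ring, Finset.sum_range_succ',
      Finset.sum_range_succ']
    have h0 : f 0 = 0 := by simp [hf]
    have h1 : f (0 + 1) = 0 := by simp [hf]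
    rw [h0, h1, add_zero, add_zero]
  -- the second derivative as a coefficient sum over the same range
  have hdeg : (derivative (derivative P)).natDegree < P.natDegree + 1 := by
    have h1 := Polynomial.natDegree_derivative_le (derivative P)
    have h2 := Polynomial.natDegree_derivative_le P
    omega
  rw [hext, hpeel, Polynomial.eval_eq_sum_range' hdeg, Finset.sum_div]
  refine Finset.sum_congr rfl fun i _ ↦ ?_
  simp only [hf, Polynomial.coeff_derivative, Nat.add_sub_cancel]
  rw [show i + 1 + 1 = i + 2 from rfl]
  push_cast
  rw [div_pow, pow_add]
  field_simp
  ring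

/-- **The profile coordinate against `P″`**: for `P` with `P₀ = P₁ = 0`, `M ≥ 3`, `1 ≤ n ≤ M`,
`|𝒮_n − E_n·P″(log(M/n)/log M)/log²M| ≤ C_P·D(n)·(1/((1+log(M/n))²log²M) + 1/log³M)`.
[cite: KowalskiMichelVanderKam2000, Prop. 5.1 — derivation (general profile, real variables)] -/
theorem abs_profileCoord_sub_derivative2_le (P : ℝ[X]) (hP0 : P.coeff 0 = 0) (hP1 : P.coeff 1 = 0) :
    ∃ C : ℝ, 0 < C ∧ ∀ M : ℝ, 3 ≤ M → ∀ n : ℕ, n ≠ 0 → (n : ℝ) ≤ M →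
      |∑ c ∈ Finset.range (P.natDegree + 1), P.coeff c *
            ((∑ k ∈ Icc 1 ⌊M / n⌋₊, copTauW n k * Real.log (M / n / k) ^ c) / Real.log M ^ c) -
          mainConst n * ((derivative (derivative P)).eval (Real.log (M / n) / Real.log M) / Real.log M ^ 2)| ≤
        C * divWeight n * (1 / ((1 + Real.log (M / n)) ^ 2 * Real.log M ^ 2) + 1 / Real.log M ^ 3) := by
  obtain ⟨C, hC, h⟩ := abs_profileCoord_sub_le P hP0 hP1
  refine ⟨C, hC, fun M hM n hn hnM ↦ ?_⟩
  have hℓ0 : Real.log M ≠ 0 := by have := one_le_log_of_three_le hM; positivity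
  rw [← sum_coeff_mul_desc_eq_derivative2_eval P hℓ0]
  exact h M hM n hn hnM

/-! ### Crude sizes -/

/-- **`|E_n·Σ_c P_c c(c−1)log^{c−2}(M/n)/logᶜM| ≤ C_P·E_n/log²M`** for `M ≥ 3`, `1 ≤ n ≤ M`
(`log^{c−2}(M/n) ≤ log^{c−2}M`). [folklore] -/
theorem abs_profileMain_le (P : ℝ[X]) :
    ∃ C : ℝ, 0 < C ∧ ∀ M : ℝ, 3 ≤ M → ∀ n : ℕ, n ≠ 0 → (n : ℝ) ≤ M →
      |mainConst n * ∑ c ∈ Finset.range (P.natDegree + 1), P.coeff c *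
            ((c : ℝ) * ((c : ℝ) - 1) * Real.log (M / n) ^ (c - 2) / Real.log M ^ c)| ≤
        C * mainConst n / Real.log M ^ 2 := by
  refine ⟨∑ c ∈ Finset.range (P.natDegree + 1), |P.coeff c| * ((c : ℝ) * (c : ℝ)) + 1, by positivity,
    fun M hM n hn hnM ↦ ?_⟩
  set ℓ := Real.log M with hℓ
  have hℓ1 : 1 ≤ ℓ := one_le_log_of_three_le hM
  have hℓ0 : 0 < ℓ := by linarith
  obtain ⟨hy0, hyℓ⟩ := log_div_nonneg_and_le hM hn hnM
  set y := Real.log (M / n) with hy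
  have hE := mainConst_nonneg n
  have hterm : ∀ c ∈ Finset.range (P.natDegree + 1),
      |P.coeff c * ((c : ℝ) * ((c : ℝ) - 1) * y ^ (c - 2) / ℓ ^ c)| ≤ |P.coeff c| * ((c : ℝ) * (c : ℝ)) / ℓ ^ 2 := by
    intro c _
    rw [abs_mul, mul_div_assoc |P.coeff c|]
    refine mul_le_mul_of_nonneg_left ?_ (abs_nonneg _)
    rcases Nat.lt_or_ge c 2 with hc | hc
    · have h0 : (c : ℝ) * ((c : ℝ) - 1) = 0 := by
        interval_cases c <;> norm_num
      rw [h0, zero_mul, zero_div, abs_zero]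
      positivity
    · obtain ⟨m, rfl⟩ : ∃ m, c = m + 2 := ⟨c - 2, by omega⟩
      have e : m + 2 - 2 = m := by omega
      rw [e, abs_div, abs_of_pos (pow_pos hℓ0 _), pow_add, abs_mul, abs_of_nonneg (pow_nonneg hy0 m)]
      have hcc : |((m + 2 : ℕ) : ℝ) * (((m + 2 : ℕ) : ℝ) - 1)| ≤ ((m + 2 : ℕ) : ℝ) * ((m + 2 : ℕ) : ℝ) := by
        have hm0 : (0 : ℝ) ≤ m := Nat.cast_nonneg m
        push_cast
        rw [abs_of_nonneg (by nlinarith)]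
        nlinarith
      have hym : y ^ m ≤ ℓ ^ m := pow_le_pow_left₀ hy0 hyℓ m
      rw [div_le_div_iff₀ (by positivity) (by positivity)]
      calc |((m + 2 : ℕ) : ℝ) * (((m + 2 : ℕ) : ℝ) - 1)| * y ^ m * ℓ ^ 2
          ≤ (((m + 2 : ℕ) : ℝ) * ((m + 2 : ℕ) : ℝ)) * ℓ ^ m * ℓ ^ 2 := by gcongr
        _ = ((m + 2 : ℕ) : ℝ) * ((m + 2 : ℕ) : ℝ) * (ℓ ^ m * ℓ ^ 2) := by ring
  rw [abs_mul, abs_of_nonneg hE]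
  calc mainConst n * |∑ c ∈ Finset.range (P.natDegree + 1), P.coeff c * ((c : ℝ) * ((c : ℝ) - 1) * y ^ (c - 2) / ℓ ^ c)|
      ≤ mainConst n * ∑ c ∈ Finset.range (P.natDegree + 1), |P.coeff c| * ((c : ℝ) * (c : ℝ)) / ℓ ^ 2 :=
        mul_le_mul_of_nonneg_left ((Finset.abs_sum_le_sum_abs _ _).trans (Finset.sum_le_sum hterm)) hE
    _ = (∑ c ∈ Finset.range (P.natDegree + 1), |P.coeff c| * ((c : ℝ) * (c : ℝ))) * mainConst n / ℓ ^ 2 := by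
        rw [← Finset.sum_div]; ring
    _ ≤ (∑ c ∈ Finset.range (P.natDegree + 1), |P.coeff c| * ((c : ℝ) * (c : ℝ)) + 1) * mainConst n / ℓ ^ 2 := by
        gcongr
        linarith

/-- **`|𝒮_n| ≤ C_P·D(n)/log²M`** for `P` with `P₀ = P₁ = 0`, `M ≥ 3`, `1 ≤ n ≤ M` (main term `≪ E_n/log²M ≪ D(n)/log²M`
plus the error of `abs_profileCoord_sub_le`). [cite: KowalskiMichelVanderKam2000, Prop. 5.1 — derivation] -/
theorem abs_profileCoord_le (P : ℝ[X]) (hP0 : P.coeff 0 = 0) (hP1 : P.coeff 1 = 0) :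
    ∃ C : ℝ, 0 < C ∧ ∀ M : ℝ, 3 ≤ M → ∀ n : ℕ, n ≠ 0 → (n : ℝ) ≤ M →
      |∑ c ∈ Finset.range (P.natDegree + 1), P.coeff c *
            ((∑ k ∈ Icc 1 ⌊M / n⌋₊, copTauW n k * Real.log (M / n / k) ^ c) / Real.log M ^ c)| ≤
        C * divWeight n / Real.log M ^ 2 := by
  obtain ⟨C₁, hC₁, h1⟩ := abs_profileCoord_sub_le P hP0 hP1
  obtain ⟨C₂, hC₂, h2⟩ := abs_profileMain_le P
  obtain ⟨C₃, hC₃, h3⟩ := mainConst_le_divWeight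
  refine ⟨2 * C₁ + C₂ * C₃, by positivity, fun M hM n hn hnM ↦ ?_⟩
  set ℓ := Real.log M with hℓ
  have hℓ1 : 1 ≤ ℓ := one_le_log_of_three_le hM
  have hℓ0 : 0 < ℓ := by linarith
  obtain ⟨hy0, hyℓ⟩ := log_div_nonneg_and_le hM hn hnM
  set y := Real.log (M / n) with hy
  have hD := divWeight_nonneg n
  have hE := mainConst_nonneg n
  have ha := h1 M hM n hn hnM
  have hb := h2 M hM n hn hnM
  have hc := h3 n hn
  set S := ∑ c ∈ Finset.range (P.natDegree + 1), P.coeff c *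
    ((∑ k ∈ Icc 1 ⌊M / n⌋₊, copTauW n k * Real.log (M / n / k) ^ c) / ℓ ^ c) with hS
  set T := mainConst n * ∑ c ∈ Finset.range (P.natDegree + 1), P.coeff c *
    ((c : ℝ) * ((c : ℝ) - 1) * y ^ (c - 2) / ℓ ^ c) with hT
  -- the error scales are both `≤ D(n)/log²M`
  have he1 : 1 / ((1 + y) ^ 2 * ℓ ^ 2) ≤ 1 / ℓ ^ 2 := by
    apply one_div_le_one_div_of_le (by positivity)
    have : 1 ≤ (1 + y) ^ 2 := one_le_pow₀ (by linarith)
    nlinarith [pow_pos hℓ0 2]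
  have he2 : 1 / ℓ ^ 3 ≤ 1 / ℓ ^ 2 :=
    one_div_le_one_div_of_le (by positivity) (pow_le_pow_right₀ hℓ1 (by norm_num))
  calc |S| = |(S - T) + T| := by ring_nf
    _ ≤ |S - T| + |T| := abs_add_le _ _
    _ ≤ C₁ * divWeight n * (1 / ((1 + y) ^ 2 * ℓ ^ 2) + 1 / ℓ ^ 3) + C₂ * mainConst n / ℓ ^ 2 := add_le_add ha hb
    _ ≤ C₁ * divWeight n * (1 / ℓ ^ 2 + 1 / ℓ ^ 2) + C₂ * (C₃ * divWeight n) / ℓ ^ 2 := by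
        gcongr
    _ = (2 * C₁ + C₂ * C₃) * divWeight n / ℓ ^ 2 := by ring

end Summit.Parity.GeneralizedHardyLittlewood.Theorems.MomentsBeyondDiagonal.DiagKernel

end
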